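import Summits.QuantumFields.YangMills.Theorems.FluctuationComparisonRegPrIntLS2BetaFaceSpreadCurlCount
import Summits.QuantumFields.YangMills.Theorems.FluctuationComparisonRegPrIntLS2BetaCombTransporter
import HarnessLib

/-!
# S2β ∕ GAP♯∘ strata residue, AVG₂♭-ax_q rough purse — THE LINEAR LADDER STOKES BOUND: along a ladder the two rung values of a tangent field differ,
# after parallel transport, by at most the sum of the unit-square circulations; in comb-axial gauge a non-tree chord is paid by the curl on its ladder
# (generic `P : Params`, `SU(2)`, `ℝ³` currency; DEFINITION-FREE)

Cell `ym3-torus` (YM ladder rung R3 = continuum `SU(2)` Yang–Mills on the three-torus — a RUNG: NOT d = 4, NOT infinite volume,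
NOT a mass gap, NOT Clay).  Width seat «width 16» `ym3-torus-px16` (gen 22), FREE px helper on crux `stmt-QuantumFields-20520`
(`FluctuationComparisonRegPrIntL`), count-neutral, DEFINITION-FREE (0 `def`, 0 `instance`, 0 `notation`, 0 `sorry`), default heartbeats.

WHY.  The last analytic letter of the S2β pairing lane, AVG₂♭-ax_q (✓p825995's `hM`; UV3-NODE §89), pays ROUGH fibre directions with the purse `N·REL`,
`REL ≈ ½Σ_p |(curl_{U₀} ζ)_p|²` (§89.4 (iv)): in comb-axial gauge a non-tree chord `ζ_b` IS the linearised holonomy of the fundamental LADDER of `b`, hence is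
bounded by the covariant curl on that ladder.  THIS FILE is that lattice statement — the linearisation of ✓(B4a) `…S2BetaLadderHolonomy.dist1_ladder_le`'s
identity `L_{n+1} = (U_{zκ} L_n U_{zκ}⁻¹)·□_z` — with NO smallness and NO `θ₀`: the triangle inequality is EXACT per unit square because `Ad` is an isometry.
WHAT.
* §1 ★★ `norm_transport_rung_sub_le_sum` (ANY word `W`, start `p`, rung axis `e`, any `U`, `ζ`; no hypothesis): with `H = U(walk p W)`, `y = walkEnd p W`, the ladder
  holonomy `Λ = H·U⟨y,e⟩·U(walk (p+e) W)⁻¹·U⟨p,e⟩⁻¹`: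
    `‖Ad_H ζ⟨y, e⟩ − Ad_Λ ζ⟨p, e⟩‖ ≤ Σ_{i < |W|} T(base_i, κ_i)`,
  `T(y′, κ) := ‖Ad_{U⟨y′,κ⟩} ζ⟨y′+e_κ, e⟩ − Ad_{□(y′; κ, e)} ζ⟨y′, e⟩‖` the RUNG DIFFERENCE ACROSS THE UNIT SQUARE `□(y′; κ, e) = U⟨y′,κ⟩U⟨y′+κ,e⟩U⟨y′+e,κ⟩⁻¹U⟨y′,e⟩⁻¹`,
  `base_i` the lower-left corner of the `i`-th square (`walkEnd p (W.take i)` for a forward letter, its `κ_i`-unshift for a backward one).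
* §2 THE SQUARE TERM IS THE CURL when the two `κ`-sides carry no field: `rungDiff_eq_norm_curl_of_lt` ∕ `_of_gt` (`T(y′, κ) = ‖(curl_{U₀} ζ)_p‖` for the plaquette `p`
  spanned by `{κ, e}` at `y′`, the curl expression of ✓p822876 ∕ ✓p825384 VERBATIM), `rungDiff_eq_zero_of_eq` (`κ = e`: degenerate, `T = 0`).
* §3 ★★★ `norm_chord_le_sum_of_vanishing` — THE CHORD OF A SURGERY CYCLE IS PAID BY ITS LADDER (the linear twin of px13 g25's ✓`dist1_surgery_cycle_le`, comb-AGNOSTIC):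
  for a root `r`, words `W₁`, `R`, an axis `ν`, a run length `m : ℤ` and `ζ` vanishing on the two paths `walk r (W₁·ν^m·R)`, `walk r (W₁·ν^{m+1}·R)` (comb paths to the
  two endpoints of `b = ⟨walkEnd r (W₁·ν^m·R), ν⟩` in ANY axial comb — px13's `stairWord σ` comb via lit ✓`T4StairWordPrefix.stairWord_update_decomp`, or the
  ONE-LEVEL `treeWord` comb of lit `B10Eq27TorusAxialLog.axialT` that `AxStage` reads (px17 g22 (4)), via lit ✓`B8Lemma1NonAbelianRecLoops.treeWord_eq_stairRuns_reverse`):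
    `‖ζ_b‖ ≤ Σ_{i<|R|} T(base_i, κ_i)` along the ladder swept by `R` from the station `walkEnd r (W₁·ν^m)`, each summand a curl norm by §2.

HONEST SCOPE.  Lattice bookkeeping + the triangle inequality in `ℝ³`; nothing of Bałaban's analysis is asserted; the pair∕single WEIGHTS of the second-order form and the
ladder MULTIPLICITY count (UV3-NODE §89.6 (w3)) are NOT here (px10 g24's core); AVG₂♭-ax_q, (D-ax), GAP♯∘ (`stub_uniformFibreGapOrbit`; registry
`Lines/semiclassical_s2beta.lean` 3732b7df UNTOUCHED), the five registered stubs, S2β, crux 20520, 19936, 19200 and `YM3TorusSU2` are NOT proved; no registered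
stub is closed; the Yang–Mills mass gap is NOT proved.  Sorry-free, axioms standard.

References: T. Bałaban, CMP **98** (1985) 17–51 [Balaban1985Averaging] ((9) p.19; (58) p.27 «axial gauge conditions in blocks»; (123) p.36, (148)–(149) p.40);
CMP **122** (1989) 355–392 [Balaban1989LargeFieldII] (p.382: a tree-gauge bond variable is a loop spanned by plaquettes); CMP **102** (1985) 277–309
[Balaban1985Variational] ((34) p.283, the covariant curl).
-/

set_option autoImplicit false

noncomputable section

open Finset Function
open Literature.MathematicalPhysics.QuantumFieldTheory.Balaban1983to89
open Literature.MathematicalPhysics.QuantumFieldTheory.Balaban1983to89.T4Continuum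
open Literature.MathematicalPhysics.QuantumFieldTheory.Balaban1983to89.T4CubeChartGnomonic (SU2)
open Literature.MathematicalPhysics.QuantumFieldTheory.Balaban1983to89.B15Prop1ChartSU2 (adSU2)
open Literature.MathematicalPhysics.QuantumFieldTheory.Balaban1983to89.B15Prop1ChartCalculusSU2 (adSU2_adSU2 adSU2_one_apply)
open Literature.MathematicalPhysics.QuantumFieldTheory.Balaban1983to89.B14.Eq22Determines (blockIter)
open Literature.MathematicalPhysics.QuantumFieldTheory.Balaban1983to89.B15DeterminingSets (embIter)
open Summit.QuantumFields.YangMills.Theorems.FluctuationComparisonRegPrIntLS2BetaCritPairOfMultiplier (norm_adSU2_le)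
open Summit.QuantumFields.YangMills.Theorems.FluctuationComparisonRegPrIntLS2BetaLadderHolonomy (unshift_shift_comm)
open Summit.QuantumFields.YangMills.Theorems.FluctuationComparisonRegPrIntLS2BetaCombTransporter (walkEnd_comb offset_shift natAbs_offset_le)

namespace Summit.QuantumFields.YangMills.Theorems.FluctuationComparisonRegPrIntLS2BetaLinearLadderStokes

variable {P : Params} {j : ℕ}

/-! ## §1 The linear ladder Stokes bound -/

/-- One rung peeled: `Ad_{U A} t − Ad_{(U Λ′ U⁻¹)·□} s = Ad_U (Ad_A t − Ad_{Λ′} r) + Ad_U (Ad_{Λ′} (r − Ad_{U⁻¹ □} s))` — the linearisation of ✓(B4a)'s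
`L_{n+1} = (U L_n U⁻¹)·□`. [folklore] -/
theorem ad_peel (U A Lam Sq : SU2) (t r s : EuclideanSpace ℝ (Fin 3)) :
    adSU2 (U * A) t - adSU2 (U * Lam * U⁻¹ * Sq) s =
      adSU2 U (adSU2 A t - adSU2 Lam r) + adSU2 U (adSU2 Lam (r - adSU2 (U⁻¹ * Sq) s)) := by
  simp only [map_sub, adSU2_adSU2]
  have h : U * (Lam * (U⁻¹ * Sq)) = U * Lam * U⁻¹ * Sq := by group
  rw [h]; abel

/-- The norm of a peeled rung: `‖Ad_{UA} t − Ad_{(UΛ′U⁻¹)□} s‖ ≤ ‖Ad_A t − Ad_{Λ′} r‖ + ‖Ad_U r − Ad_□ s‖` (`Ad` does not increase norms). [folklore] -/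
theorem norm_peel_le (U A Lam Sq : SU2) (t r s : EuclideanSpace ℝ (Fin 3)) :
    ‖adSU2 (U * A) t - adSU2 (U * Lam * U⁻¹ * Sq) s‖ ≤ ‖adSU2 A t - adSU2 Lam r‖ + ‖adSU2 U r - adSU2 Sq s‖ := by
  rw [ad_peel U A Lam Sq t r s]
  refine (norm_add_le _ _).trans (add_le_add ((norm_adSU2_le _ _).trans le_rfl) ?_)
  refine (norm_adSU2_le _ _).trans ((norm_adSU2_le _ _).trans ?_)
  have h : r - adSU2 (U⁻¹ * Sq) s = adSU2 U⁻¹ (adSU2 U r - adSU2 Sq s) := by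
    rw [map_sub, adSU2_adSU2, adSU2_adSU2, inv_mul_cancel, adSU2_one_apply]
  rw [h]
  exact norm_adSU2_le _ _

/-- ★★ **THE LINEAR LADDER STOKES BOUND.**  For ANY configuration `U`, tangent field `ζ`, word `W`, start `p` and rung axis `e`, with `H = U(walk p W)`, `y = walkEnd p W`
and the ladder holonomy `Λ = H·U⟨y,e⟩·U(walk (p + e) W)⁻¹·U⟨p,e⟩⁻¹`:
  `‖Ad_H ζ⟨y,e⟩ − Ad_Λ ζ⟨p,e⟩‖ ≤ Σ_{i<|W|} ‖Ad_{U⟨y_i,κ_i⟩} ζ⟨y_i + e_{κ_i}, e⟩ − Ad_{□(y_i; κ_i, e)} ζ⟨y_i, e⟩‖`,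
`y_i` the lower corner of the `i`-th unit square of the ladder (`walkEnd p (W.take i)`, unshifted by `κ_i` for a backward letter) — the rung values telescope
through the squares; no smallness, no hypothesis. [cite: Balaban1989LargeFieldII, p.382; Balaban1985Averaging, (9) p.19] -/
theorem norm_transport_rung_sub_le_sum (U : GaugeField P j SU2) (ζ : PBond P j → EuclideanSpace ℝ (Fin 3)) (e : Fin P.d) :
    ∀ (W : List (Letter P.d)) (p : Site P j),
      ‖adSU2 (holAt U (walk p W)) (ζ ⟨walkEnd p W, e⟩) -
          adSU2 (holAt U (walk p W) * U ⟨walkEnd p W, e⟩ * (holAt U (walk (p.shift e) W))⁻¹ * (U ⟨p, e⟩)⁻¹) (ζ ⟨p, e⟩)‖ ≤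
        ∑ i ∈ Finset.range W.length,
          ‖adSU2 (U ⟨(if (W.getD i (e, true)).2 then walkEnd p (W.take i) else (walkEnd p (W.take i)).unshift (W.getD i (e, true)).1),
                  (W.getD i (e, true)).1⟩)
                (ζ ⟨(if (W.getD i (e, true)).2 then walkEnd p (W.take i) else (walkEnd p (W.take i)).unshift (W.getD i (e, true)).1).shift
                  (W.getD i (e, true)).1, e⟩) -
              adSU2 (U ⟨(if (W.getD i (e, true)).2 then walkEnd p (W.take i) else (walkEnd p (W.take i)).unshift (W.getD i (e, true)).1),
                    (W.getD i (e, true)).1⟩ *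
                  U ⟨(if (W.getD i (e, true)).2 then walkEnd p (W.take i) else (walkEnd p (W.take i)).unshift (W.getD i (e, true)).1).shift
                    (W.getD i (e, true)).1, e⟩ *
                  (U ⟨(if (W.getD i (e, true)).2 then walkEnd p (W.take i) else (walkEnd p (W.take i)).unshift (W.getD i (e, true)).1).shift e,
                    (W.getD i (e, true)).1⟩)⁻¹ *
                  (U ⟨(if (W.getD i (e, true)).2 then walkEnd p (W.take i) else (walkEnd p (W.take i)).unshift (W.getD i (e, true)).1), e⟩)⁻¹)
                (ζ ⟨(if (W.getD i (e, true)).2 then walkEnd p (W.take i) else (walkEnd p (W.take i)).unshift (W.getD i (e, true)).1), e⟩)‖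
  | [], p => by
    simp only [walk, walkEnd, holAt_nil, one_mul, inv_one, mul_one, mul_inv_cancel, adSU2_one_apply, sub_self, norm_zero,
      List.length_nil, Finset.range_zero, Finset.sum_empty, le_refl]
  | (κ, true) :: W, p => by
    have ih := norm_transport_rung_sub_le_sum U ζ e W (p.shift κ)
    rw [List.length_cons, Finset.sum_range_succ']
    simp only [walk, walkEnd, holAt_cons, if_true, List.getD_cons_zero, List.take_zero, List.getD_cons_succ, List.take_succ_cons]
    rw [BlockAveragingEMLProp2.shift_shift_comm p e κ]
    have key : U ⟨p, κ⟩ * holAt U (walk (p.shift κ) W) * U ⟨walkEnd (p.shift κ) W, e⟩ *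
          (U ⟨p.shift e, κ⟩ * holAt U (walk ((p.shift κ).shift e) W))⁻¹ * (U ⟨p, e⟩)⁻¹ =
        U ⟨p, κ⟩ * (holAt U (walk (p.shift κ) W) * U ⟨walkEnd (p.shift κ) W, e⟩ * (holAt U (walk ((p.shift κ).shift e) W))⁻¹ *
            (U ⟨p.shift κ, e⟩)⁻¹) * (U ⟨p, κ⟩)⁻¹ *
          (U ⟨p, κ⟩ * U ⟨p.shift κ, e⟩ * (U ⟨p.shift e, κ⟩)⁻¹ * (U ⟨p, e⟩)⁻¹) := by group
    rw [key]
    exact (norm_peel_le _ _ _ _ _ (ζ ⟨p.shift κ, e⟩) _).trans (add_le_add ih le_rfl)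
  | (κ, false) :: W, p => by
    have ih := norm_transport_rung_sub_le_sum U ζ e W (p.unshift κ)
    rw [List.length_cons, Finset.sum_range_succ']
    simp only [walk, walkEnd, holAt_cons, Bool.false_eq_true, if_false, List.getD_cons_zero, List.take_zero, List.getD_cons_succ,
      List.take_succ_cons]
    rw [← unshift_shift_comm p κ e]
    set p' := p.unshift κ with hp'
    have hp : p = p'.shift κ := (Site.shift_unshift p κ).symm
    set A := holAt U (walk p' W)
    set B := holAt U (walk (p'.shift e) W)
    set y := walkEnd p' W
    set Sq := U ⟨p', κ⟩ * U ⟨p'.shift κ, e⟩ * (U ⟨p'.shift e, κ⟩)⁻¹ * (U ⟨p', e⟩)⁻¹ with hSq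
    have hiso : ∀ (g : SU2) (v : EuclideanSpace ℝ (Fin 3)), ‖adSU2 g v‖ = ‖v‖ := fun g v =>
      le_antisymm (norm_adSU2_le g v) (by
        calc ‖v‖ = ‖adSU2 g⁻¹ (adSU2 g v)‖ := by rw [adSU2_adSU2, inv_mul_cancel, adSU2_one_apply]
          _ ≤ ‖adSU2 g v‖ := norm_adSU2_le _ _)
    rw [hp]
    -- `L(p) = (U⁻¹ L′ U⁻¹⁻¹) · (U⁻¹ □⁻¹ U)` with `U = U⟨p′,κ⟩`, `□` the square at `p′` (✓(B4a)'s backward `key`)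
    have key : (U ⟨p', κ⟩)⁻¹ * A * U ⟨y, e⟩ * ((U ⟨p'.shift e, κ⟩)⁻¹ * B)⁻¹ * (U ⟨p'.shift κ, e⟩)⁻¹ =
        (U ⟨p', κ⟩)⁻¹ * (A * U ⟨y, e⟩ * B⁻¹ * (U ⟨p', e⟩)⁻¹) * (U ⟨p', κ⟩)⁻¹⁻¹ * ((U ⟨p', κ⟩)⁻¹ * Sq⁻¹ * U ⟨p', κ⟩) := by
      rw [hSq]; group
    rw [key]
    refine (norm_peel_le ((U ⟨p', κ⟩)⁻¹) A (A * U ⟨y, e⟩ * B⁻¹ * (U ⟨p', e⟩)⁻¹) ((U ⟨p', κ⟩)⁻¹ * Sq⁻¹ * U ⟨p', κ⟩)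
      (ζ ⟨y, e⟩) (ζ ⟨p', e⟩) (ζ ⟨p'.shift κ, e⟩)).trans (add_le_add ih (le_of_eq ?_))
    -- the square term, traversed backwards: an isometric conjugation and a sign
    have h2 : adSU2 (U ⟨p', κ⟩)⁻¹ (ζ ⟨p', e⟩) - adSU2 ((U ⟨p', κ⟩)⁻¹ * Sq⁻¹ * U ⟨p', κ⟩) (ζ ⟨p'.shift κ, e⟩) =
        adSU2 ((U ⟨p', κ⟩)⁻¹ * Sq⁻¹) (adSU2 Sq (ζ ⟨p', e⟩) - adSU2 (U ⟨p', κ⟩) (ζ ⟨p'.shift κ, e⟩)) := by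
      rw [map_sub, adSU2_adSU2, adSU2_adSU2, show (U ⟨p', κ⟩)⁻¹ * Sq⁻¹ * Sq = (U ⟨p', κ⟩)⁻¹ by group]
    rw [h2, hiso, ← norm_neg, neg_sub]

/-! ## §2 The square term is the covariant curl when the two `κ`-sides carry no field -/

/-- `Ad` is an isometry of `ℝ³` (re-derived from ✓`norm_adSU2_le` both ways). [cite: Balaban1989LargeFieldI, (1.77) p.194] -/
theorem norm_adSU2_eq' (g : SU2) (v : EuclideanSpace ℝ (Fin 3)) : ‖adSU2 g v‖ = ‖v‖ :=
  le_antisymm (norm_adSU2_le g v) (by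
    calc ‖v‖ = ‖adSU2 g⁻¹ (adSU2 g v)‖ := by rw [adSU2_adSU2, inv_mul_cancel, adSU2_one_apply]
      _ ≤ ‖adSU2 g v‖ := norm_adSU2_le _ _)

/-- **THE SQUARE TERM IS THE CURL, `κ < e`**: if `ζ⟨y,κ⟩ = 0 = ζ⟨y+e_e, κ⟩`, the rung difference across `□(y; κ, e)` is the norm of the covariant curl (✓p822876's
expression VERBATIM) of the plaquette `⟨y, κ, e⟩`. [cite: Balaban1985Variational, (34) p.283; Balaban1985Averaging, (9) p.19] -/
theorem rungDiff_eq_norm_curl_of_lt (U : GaugeField P j SU2) (ζ : PBond P j → EuclideanSpace ℝ (Fin 3)) {y : Site P j} {κ e : Fin P.d} (hκe : κ < e)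
    (h1 : ζ ⟨y, κ⟩ = 0) (h2 : ζ ⟨y.shift e, κ⟩ = 0) :
    ‖adSU2 (U ⟨y, κ⟩) (ζ ⟨y.shift κ, e⟩) - adSU2 (U ⟨y, κ⟩ * U ⟨y.shift κ, e⟩ * (U ⟨y.shift e, κ⟩)⁻¹ * (U ⟨y, e⟩)⁻¹) (ζ ⟨y, e⟩)‖ =
      ‖adSU2 (GaugeField.plaqHol U ⟨y, κ, e, hκe⟩)⁻¹ (ζ ⟨y, κ⟩) +
          adSU2 ((GaugeField.plaqHol U ⟨y, κ, e, hκe⟩)⁻¹ * U ⟨y, κ⟩) (ζ ⟨y.shift κ, e⟩) -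
          adSU2 ((GaugeField.plaqHol U ⟨y, κ, e, hκe⟩)⁻¹ * U ⟨y, κ⟩ * U ⟨y.shift κ, e⟩ * (U ⟨y.shift e, κ⟩)⁻¹) (ζ ⟨y.shift e, κ⟩) -
          ζ ⟨y, e⟩‖ := by
  set Sq := GaugeField.plaqHol U ⟨y, κ, e, hκe⟩ with hSq
  have hSq' : U ⟨y, κ⟩ * U ⟨y.shift κ, e⟩ * (U ⟨y.shift e, κ⟩)⁻¹ * (U ⟨y, e⟩)⁻¹ = Sq := rfl
  rw [hSq', h1, h2, map_zero, map_zero, zero_add, sub_zero]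
  have h : adSU2 (U ⟨y, κ⟩) (ζ ⟨y.shift κ, e⟩) - adSU2 Sq (ζ ⟨y, e⟩) =
      adSU2 Sq (adSU2 (Sq⁻¹ * U ⟨y, κ⟩) (ζ ⟨y.shift κ, e⟩) - ζ ⟨y, e⟩) := by
    rw [map_sub, adSU2_adSU2, ← mul_assoc, mul_inv_cancel, one_mul]
  rw [h, norm_adSU2_eq']

/-- **THE SQUARE TERM IS THE CURL, `e < κ`**: same, with the plaquette `⟨y, e, κ⟩` (the unit square traversed the other way; `□·U⟨y,e⟩U⟨y+e,κ⟩U⟨y+κ,e⟩⁻¹ = U⟨y,κ⟩`).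
[cite: Balaban1985Variational, (34) p.283; Balaban1985Averaging, (9) p.19] -/
theorem rungDiff_eq_norm_curl_of_gt (U : GaugeField P j SU2) (ζ : PBond P j → EuclideanSpace ℝ (Fin 3)) {y : Site P j} {κ e : Fin P.d} (heκ : e < κ)
    (h1 : ζ ⟨y, κ⟩ = 0) (h2 : ζ ⟨y.shift e, κ⟩ = 0) :
    ‖adSU2 (U ⟨y, κ⟩) (ζ ⟨y.shift κ, e⟩) - adSU2 (U ⟨y, κ⟩ * U ⟨y.shift κ, e⟩ * (U ⟨y.shift e, κ⟩)⁻¹ * (U ⟨y, e⟩)⁻¹) (ζ ⟨y, e⟩)‖ =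
      ‖adSU2 (GaugeField.plaqHol U ⟨y, e, κ, heκ⟩)⁻¹ (ζ ⟨y, e⟩) +
          adSU2 ((GaugeField.plaqHol U ⟨y, e, κ, heκ⟩)⁻¹ * U ⟨y, e⟩) (ζ ⟨y.shift e, κ⟩) -
          adSU2 ((GaugeField.plaqHol U ⟨y, e, κ, heκ⟩)⁻¹ * U ⟨y, e⟩ * U ⟨y.shift e, κ⟩ * (U ⟨y.shift κ, e⟩)⁻¹) (ζ ⟨y.shift κ, e⟩) -
          ζ ⟨y, κ⟩‖ := by
  have hP : (GaugeField.plaqHol U ⟨y, e, κ, heκ⟩)⁻¹ = U ⟨y, κ⟩ * U ⟨y.shift κ, e⟩ * (U ⟨y.shift e, κ⟩)⁻¹ * (U ⟨y, e⟩)⁻¹ := by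
    simp only [GaugeField.plaqHol]; group
  have hT : (GaugeField.plaqHol U ⟨y, e, κ, heκ⟩)⁻¹ * U ⟨y, e⟩ * U ⟨y.shift e, κ⟩ * (U ⟨y.shift κ, e⟩)⁻¹ = U ⟨y, κ⟩ := by
    simp only [GaugeField.plaqHol]; group
  rw [hT, hP, h1, h2, map_zero, add_zero, sub_zero, ← norm_neg, neg_sub]

/-- The degenerate square `κ = e`: if `ζ⟨y,e⟩ = 0 = ζ⟨y+e_e, e⟩` the term vanishes. [folklore] -/
theorem rungDiff_eq_zero_of_eq (U : GaugeField P j SU2) (ζ : PBond P j → EuclideanSpace ℝ (Fin 3)) {y : Site P j} {e : Fin P.d}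
    (h1 : ζ ⟨y, e⟩ = 0) (h2 : ζ ⟨y.shift e, e⟩ = 0) :
    ‖adSU2 (U ⟨y, e⟩) (ζ ⟨y.shift e, e⟩) - adSU2 (U ⟨y, e⟩ * U ⟨y.shift e, e⟩ * (U ⟨y.shift e, e⟩)⁻¹ * (U ⟨y, e⟩)⁻¹) (ζ ⟨y, e⟩)‖ = 0 := by
  rw [h1, h2, map_zero, map_zero, sub_zero, norm_zero]

/-! ## §3 The surgery form: a comb cycle's chord is paid by the ladder of the later runs -/

/-- ★★★ **THE CHORD OF A SURGERY CYCLE IS PAID BY ITS LADDER** (the linear twin of px13 g25's ✓`dist1_surgery_cycle_le`): for a root `r`, words `W₁`, `R`, an axis `ν`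
and a run length `m : ℤ`, if the tangent field `ζ` VANISHES on every bond of the two comb paths `walk r (W₁·ν^m·R)` and `walk r (W₁·ν^{m+1}·R)` (which differ by the one
bond `b = ⟨walkEnd r (W₁·ν^m·R), ν⟩` joining their ends), then
  `‖ζ_b‖ ≤ Σ_{i<|R|} T(base_i, κ_i)`  along the ladder swept by `R` from the station `s₀ = walkEnd r (W₁·ν^m)` with rung axis `ν`
(§1 with the bottom rung `⟨s₀, ν⟩` a comb bond: for `m ≥ 0` it is the extra forward letter, for `m < 0` the dropped backward one). Each `T_i` is a curl norm by §2 (the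
`κ_i`-sides of the `i`-th square lie on the two paths). [cite: Balaban1987RG1, (0.3) p.252; Balaban1989LargeFieldII, p.382; Balaban1985Averaging, (9) p.19, (58) p.27] -/
theorem norm_chord_le_sum_of_vanishing (U : GaugeField P j SU2) (ζ : PBond P j → EuclideanSpace ℝ (Fin 3)) (r : Site P j) (W₁ R : List (Letter P.d))
    (ν : Fin P.d) (m : ℤ)
    (hζ1 : ∀ s ∈ walk r (W₁ ++ axisRun ν m ++ R), ζ s.bond = 0) (hζ2 : ∀ s ∈ walk r (W₁ ++ axisRun ν (m + 1) ++ R), ζ s.bond = 0) :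
    ‖ζ ⟨walkEnd r (W₁ ++ axisRun ν m ++ R), ν⟩‖ ≤
      ∑ i ∈ Finset.range R.length,
        ‖adSU2 (U ⟨(if (R.getD i (ν, true)).2 then walkEnd (walkEnd r (W₁ ++ axisRun ν m)) (R.take i)
              else (walkEnd (walkEnd r (W₁ ++ axisRun ν m)) (R.take i)).unshift (R.getD i (ν, true)).1), (R.getD i (ν, true)).1⟩)
            (ζ ⟨(if (R.getD i (ν, true)).2 then walkEnd (walkEnd r (W₁ ++ axisRun ν m)) (R.take i)
              else (walkEnd (walkEnd r (W₁ ++ axisRun ν m)) (R.take i)).unshift (R.getD i (ν, true)).1).shift (R.getD i (ν, true)).1, ν⟩) -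
          adSU2 (U ⟨(if (R.getD i (ν, true)).2 then walkEnd (walkEnd r (W₁ ++ axisRun ν m)) (R.take i)
                else (walkEnd (walkEnd r (W₁ ++ axisRun ν m)) (R.take i)).unshift (R.getD i (ν, true)).1), (R.getD i (ν, true)).1⟩ *
              U ⟨(if (R.getD i (ν, true)).2 then walkEnd (walkEnd r (W₁ ++ axisRun ν m)) (R.take i)
                else (walkEnd (walkEnd r (W₁ ++ axisRun ν m)) (R.take i)).unshift (R.getD i (ν, true)).1).shift (R.getD i (ν, true)).1, ν⟩ *
              (U ⟨(if (R.getD i (ν, true)).2 then walkEnd (walkEnd r (W₁ ++ axisRun ν m)) (R.take i)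
                else (walkEnd (walkEnd r (W₁ ++ axisRun ν m)) (R.take i)).unshift (R.getD i (ν, true)).1).shift ν, (R.getD i (ν, true)).1⟩)⁻¹ *
              (U ⟨(if (R.getD i (ν, true)).2 then walkEnd (walkEnd r (W₁ ++ axisRun ν m)) (R.take i)
                else (walkEnd (walkEnd r (W₁ ++ axisRun ν m)) (R.take i)).unshift (R.getD i (ν, true)).1), ν⟩)⁻¹)
            (ζ ⟨(if (R.getD i (ν, true)).2 then walkEnd (walkEnd r (W₁ ++ axisRun ν m)) (R.take i)
              else (walkEnd (walkEnd r (W₁ ++ axisRun ν m)) (R.take i)).unshift (R.getD i (ν, true)).1), ν⟩)‖ := by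
  set s₀ := walkEnd r (W₁ ++ axisRun ν m) with hs₀
  have hlad := norm_transport_rung_sub_le_sum U ζ ν R s₀
  -- the end of the first path is the top of the ladder
  have hend : walkEnd r (W₁ ++ axisRun ν m ++ R) = walkEnd s₀ R := by rw [walkEnd_append, hs₀]
  -- the bottom rung `⟨s₀, ν⟩` carries no field: it is a comb bond of one of the two paths
  have hbot : ζ ⟨s₀, ν⟩ = 0 := by
    rcases le_or_gt 0 m with hm | hm
    · refine hζ2 ⟨⟨s₀, ν⟩, true⟩ ?_
      rw [T4StairWordPrefix.axisRun_succ_of_nonneg ν hm, ← List.append_assoc W₁, walk_append, walk_append]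
      refine List.mem_append_left _ (List.mem_append_right _ ?_)
      rw [walkEnd_append] at hs₀
      simp [walk, hs₀, walkEnd_append]
    · refine hζ1 ⟨⟨s₀, ν⟩, false⟩ ?_
      rw [T4StairWordPrefix.axisRun_eq_append_of_neg ν hm, ← List.append_assoc W₁, walk_append, walk_append]
      refine List.mem_append_left _ (List.mem_append_right _ ?_)
      have hs' : s₀ = (walkEnd r (W₁ ++ axisRun ν (m + 1))).unshift ν := by
        rw [hs₀, T4StairWordPrefix.axisRun_eq_append_of_neg ν hm, ← List.append_assoc, walkEnd_append]; rfl
      rw [hs']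
      simp [walk]
  rw [hend]
  rw [hbot, map_zero, sub_zero, norm_adSU2_eq'] at hlad
  exact hlad

end Summit.QuantumFields.YangMills.Theorems.FluctuationComparisonRegPrIntLS2BetaLinearLadderStokes

end
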